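import Literature.NumberTheory.QuadraticFields.SqrtNegTwoGrossencharakter
import Mathlib.NumberTheory.LegendreSymbol.JacobiSymbol
import HarnessLib

/-!
# The `χ₄`-twisted Größencharakter `ψ₄(𝔭) = ψ(𝔭) · χ₄(N𝔭)` of `ℚ(√−2)` modulo `(4√−2)` — the ideal-theoretic Hecke character of
# `B₁ : y² = x³ + 4x² + 2x` (`256a1`-model; `a_p(B₁) = (−1/p) S(p)`)

Topic `Literature/NumberTheory/QuadraticFields`, namespace `Literature.NumberTheory.QuadraticFields.SqrtNegTwo`.  THEOREMS and one definition (`psiFour`);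
no instance, no notation, no named fact.  Sequel of `SqrtNegTwoGrossencharakter` (Rajwade's character `psi`: `𝔭 = (π) ↦ σ(π)`, `π` primary, modulo
`(4√−2)`; `a_p(B₋₁) = S(p)`).  The member `B₁` of Rajwade's family `B_n : y² = x³ + 4n x² + 2n² x` has `a_m(B₁) = (−1/m) S(m)` (tree:
`SqrtTwoTwist.lFunction_eq_jacobiSym_mul_primarySum`, `n = 1`), i.e. its Größencharakter is `ψ · χ₄∘N` with Kronecker's `χ₄ = (−1/·) = (−4/·)`;
since the conductor `(4)` of `χ₄∘N` divides `(4√−2)`, the modulus is unchanged.  (The spine's quadratic-twist layer twists only by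
discriminants prime to the bad prime `2`, so the `j = 8000` row needs both base curves `B₋₁` and `B₁ = B₋₁^{(−1)}`.)

* §1 `natCast_dvd_norm_sub_norm` (`N b ≡ N c (mod m)` for `b ≡ c (mod m)` in `ℤ[√−2]`), `χ₄` bookkeeping;
* §2 ★ `psiFour hK e v = ψ(v) · χ₄(N(gen v))`, `idealPow_psiFour_span : ψ̃₄((b)) = e(primary b) · χ₄(N b)`, `psiFour_smul_eq_conj`,
  `idealPow_psiFour_span_natCast_of_mod_eight` (`ψ̃₄((n)) = −n` for `n ≡ 5, 7 (mod 8)`: the integer formula feeding the ramification brick);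
* §3 ★★ `isGrossencharakter_psiFour : IsGrossencharakter (4√−2) (embType e) (embTypeConj e) ψ₄` and `isGrossencharakter_psiFour_one_zero`;
* §4 ★★ `frobenius_psiFour_of_eq` — at `v ∣ p`, `p ≠ 2`, against an integer `a_p` with `a_p = χ₄(p) S(p)` in `ℤ[√−2]`: split
  `ψ₄(v) + ψ₄(c • v) = a_p`, `ψ₄(v) ψ₄(c • v) = p`; inert `a_p = 0`, `ψ₄(v) = −p`; packaged `exists_isGrossencharakter_datum_chiFour`,
  `exists_heckeCharacter_of_eq_chiFour_mul_primarySum` (type `(1, 0)`, via `heckeOfGross`).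

Nothing about BSD is proved here; no modularity is used.

## References
* A. R. Rajwade, *Arithmetic on curves with complex multiplication by √−2*, Proc. Cambridge Philos. Soc. 64 (1968), Thm. 1. [Rajwade1968]
* J. H. Silverman, *Advanced Topics in the Arithmetic of Elliptic Curves* (1994), II Thm. 9.2, Thm. 10.5, Ex. 2.30–2.32. [SilvermanATAEC1994]
* J. Neukirch, *Algebraic Number Theory* (1999), Ch. VII §6 Def. (6.1), Cor. (6.14). [NeukirchANT1999]

## Mathlib / tree search
Tree: `SqrtNegTwo.{psi, gen, idealPow_gen_span, psi_smul_eq_conj, frobenius, inert_of_norm_gen_eq_sq, split_of_norm_gen_eq, norm_gen_eq_or, norm_eq_of_associated,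
associated_gen_smul, modulus_le_iff, sqrtIdeal_le_iff, re_gen_odd, not_modulus_le_of_natCast_mem, modulus_le_iff_two_mem, primaryHom, primary_mul_eq_primary_mul_of_dvd_sub,
isGrossencharakter_psi}`, `SqrtNegTwoPrimary.{primary_of_isUnit, primary_natCast_of_mod_eight, norm_emod_two}`, `GaloisRepresentations.{IsGrossencharakter, heckeOfGross*}`.
Mathlib: `ZMod.χ₄`, `ZMod.isQuadratic_χ₄`, `ZMod.χ₄_nat_eq_if_mod_four`, `ZMod.χ₄_int_mod_four`, `jacobiSym.at_neg_one`, `Zsqrtd.{norm_mul, norm_conj, norm_natCast}`.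
-/

noncomputable section

open NumberField IsDedekindDomain
open scoped NumberTheorySymbols ComplexConjugate Pointwise

namespace Literature.NumberTheory.QuadraticFields.SqrtNegTwo

open Literature.NumberTheory.QuadraticFields.SqrtNegTwoPrimary ZMod
open Literature.NumberTheory.GaloisRepresentations (IsGrossencharakter HeckeCharacter embType embTypeConj prod_embedding_zpow_embType
  heckeOfGross heckeOfGross_hasInfinityType heckeOfGross_isUnramifiedAt heckeOfGross_valueAtUniformizer)
open Literature.NumberTheory.LFunctions (idealPow)

variable {K : Type*} [Field K] [NumberField K] {θ : K}

/-! ### §1 Norm congruences and `χ₄` -/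

/-- `N(b) ≡ N(c) (mod m)` for `b ≡ c (mod m)` in `ℤ[√−2]`. [cite: Rajwade1968, Thm. 1] -/
theorem natCast_dvd_norm_sub_norm {m : ℕ} {b c : ℤ√(-2)} (hbc : (m : ℤ√(-2)) ∣ b - c) : (m : ℤ) ∣ b.norm - c.norm := by
  obtain ⟨t, ht⟩ := hbc
  have hb : b = c + (m : ℤ√(-2)) * t := by rw [← ht]; abel
  refine ⟨2 * c.re * t.re + m * t.re ^ 2 + 2 * (2 * c.im * t.im + m * t.im ^ 2), ?_⟩
  rw [hb, norm_def', norm_def']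
  simp only [Zsqrtd.re_add, Zsqrtd.im_add, Zsqrtd.re_mul, Zsqrtd.im_mul, Zsqrtd.re_natCast, Zsqrtd.im_natCast, zero_mul, mul_zero,
    add_zero]
  ring

/-- The value `χ₄(N z) ∈ ℂ`. [cite: Rajwade1968, Thm. 1] -/
theorem chiFour_sq_eq_one_of_odd {n : ℤ} (hn : n % 2 = 1) : ((χ₄ (n : ZMod 4) : ℤ) : ℂ) ^ 2 = 1 := by
  rw [χ₄_int_eq_if_mod_four]
  have : n % 4 = 1 ∨ n % 4 = 3 := by omega
  rcases this with h | h
  · rw [if_neg (by omega), if_pos h]; norm_num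
  · rw [if_neg (by omega), if_neg (by omega)]; norm_num

/-- `χ₄(n) ≠ 0` for odd `n`. [cite: Rajwade1968, Thm. 1] -/
theorem chiFour_ne_zero_of_odd {n : ℤ} (hn : n % 2 = 1) : ((χ₄ (n : ZMod 4) : ℤ) : ℂ) ≠ 0 := by
  intro h
  have := chiFour_sq_eq_one_of_odd hn
  rw [h] at this; norm_num at this

section Twist

variable (hK : FieldData θ)
include hK

/-! ### §2 The twisted character `ψ₄ = ψ · χ₄∘N` -/

/-- ★ **`ψ₄(𝔭_v) = ψ(𝔭_v) · χ₄(N 𝔭_v)`**, `N𝔭_v = N(gen v)`: the ideal character of `B₁ : y² = x³ + 4x² + 2x` (`a_p = (−1/p)(π + π̄)`,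
Rajwade's Thm. 1 at `n = 1`). [cite: Rajwade1968, Thm. 1] -/
def psiFour (e : K →+* ℂ) (v : HeightOneSpectrum (𝓞 K)) : ℂ := psi hK e v * ((χ₄ (((gen hK v).norm : ℤ) : ZMod 4) : ℤ) : ℂ)

/-- Unfolding `psiFour`. [cite: Rajwade1968, Thm. 1] -/
theorem psiFour_apply (e : K →+* ℂ) (v : HeightOneSpectrum (𝓞 K)) :
    psiFour hK e v = psi hK e v * ((χ₄ (((gen hK v).norm : ℤ) : ZMod 4) : ℤ) : ℂ) := rfl

/-- The multiplicative function `z ↦ e(primary z) · χ₄(N z)` on `ℤ[√−2]`, trivial on units. [cite: Rajwade1968, Thm. 1] -/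
theorem exists_monoidHom_primary_mul_chiFour (e : K →+* ℂ) :
    ∃ T : ℤ√(-2) →* ℂ, (∀ z, T z = hK.toComplex e (primary z) * ((χ₄ ((z.norm : ℤ) : ZMod 4) : ℤ) : ℂ)) ∧
      ∀ u : ℤ√(-2), IsUnit u → T u = 1 := by
  refine ⟨{ toFun := fun z => hK.toComplex e (primary z) * ((χ₄ ((z.norm : ℤ) : ZMod 4) : ℤ) : ℂ)
            map_one' := by rw [primary_of_isUnit isUnit_one, map_one, Zsqrtd.norm_one, Int.cast_one, map_one, Int.cast_one, mul_one]
            map_mul' := fun z w => by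
              rw [primary_mul, map_mul, Zsqrtd.norm_mul, Int.cast_mul, map_mul, Int.cast_mul]; ring },
    fun z => rfl, fun u hu => ?_⟩
  change hK.toComplex e (primary u) * ((χ₄ ((u.norm : ℤ) : ZMod 4) : ℤ) : ℂ) = 1
  rw [primary_of_isUnit hu, map_one, (Zsqrtd.norm_eq_one_iff' (by norm_num) u).mpr hu, Int.cast_one, map_one, Int.cast_one, mul_one]

/-- ★ **`ψ̃₄((b)) = e(primary b) · χ₄(N b)`** for every nonzero `b ∈ 𝓞 K`. [cite: Rajwade1968, Thm. 1] [cite: NeukirchANT1999, Ch. VII §6 Def. (6.1)] -/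
theorem idealPow_psiFour_span (e : K →+* ℂ) {b : 𝓞 K} (hb : b ≠ 0) :
    idealPow K (psiFour hK e) (Ideal.span {b}) =
      hK.toComplex e (primary (hK.ringEquiv.symm b)) * ((χ₄ (((hK.ringEquiv.symm b).norm : ℤ) : ZMod 4) : ℤ) : ℂ) := by
  obtain ⟨T, hT, hTu⟩ := exists_monoidHom_primary_mul_chiFour hK e
  have h := idealPow_gen_span hK T hTu hb
  simp only [hT] at h
  exact h

/-- `ψ̃₄((n)) = −n` for `n ≡ 5, 7 (mod 8)` (`primary n = −n`, `χ₄(n²) = 1`) — the integer formula for the ramification of `heckeOfGross ψ₄` at `√−2`.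
[cite: Rajwade1968, Thm. 1] -/
theorem idealPow_psiFour_span_natCast_of_mod_eight (e : K →+* ℂ) {n : ℕ} (hn8 : n % 8 = 5 ∨ n % 8 = 7) :
    idealPow K (psiFour hK e) (Ideal.span {(n : 𝓞 K)}) = -(n : ℂ) := by
  have hn0 : (n : 𝓞 K) ≠ 0 := by
    have : n ≠ 0 := by omega
    exact_mod_cast this
  have hχ : ((χ₄ ((((n : ℤ√(-2))).norm : ℤ) : ZMod 4) : ℤ) : ℂ) = 1 := by
    rw [Zsqrtd.norm_natCast, Int.cast_mul, Int.cast_natCast, map_mul, Int.cast_mul, ← sq, ← Int.cast_natCast]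
    exact chiFour_sq_eq_one_of_odd (by omega)
  rw [idealPow_psiFour_span hK e hn0, ← hK.ringEquiv_natCast, RingEquiv.symm_apply_apply, primary_natCast_of_mod_eight hn8, map_neg,
    map_natCast, hχ, mul_one]

/-- ★ `ψ₄(c • 𝔭) = conj ψ₄(𝔭)` (`χ₄` is real, `N(c • 𝔭) = N𝔭`). [cite: SilvermanATAEC1994, II Ex. 2.30 (b)] -/
theorem psiFour_smul_eq_conj (e : K →+* ℂ) {c : K ≃ₐ[ℚ] K} (hc : c ≠ 1) (v : HeightOneSpectrum (𝓞 K)) :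
    psiFour hK e (c • v) = conj (psiFour hK e v) := by
  have hN : (gen hK (c • v)).norm = (gen hK v).norm := by
    rw [norm_eq_of_associated (associated_gen_smul hK hc v), Zsqrtd.norm_conj]
  rw [psiFour_apply, psiFour_apply, hN, psi_smul_eq_conj hK e hc, map_mul]
  congr 1
  exact (map_intCast (starRingEnd ℂ) _).symm

/-! ### §3 `ψ₄` is a Größencharakter modulo `(4√−2)` of infinity type `(1, 0)` -/

/-- ★★ **`ψ₄` is a Größencharakter `mod (4√−2)` of infinity type `(1, 0)` at the place of `e`**: for `b ≡ c (mod 4√−2)`,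
`primary b · c = primary c · b` and `N b ≡ N c (mod 4)`, so `ψ̃₄((b)) = ψ̃₄((c)) · e(b/c)`. [cite: Rajwade1968, Thm. 1] [cite: NeukirchANT1999, Ch. VII §6 Def. (6.1) and Cor. (6.14)] -/
theorem isGrossencharakter_psiFour (e : K →+* ℂ) : IsGrossencharakter hK.modulus (embType e) (embTypeConj e) (psiFour hK e) := by
  refine ⟨fun v hv => ?_, fun b c hb hc hcop hbc _ => ?_⟩
  · have hv' : ¬ hK.sqrtIdeal ≤ v.asIdeal := fun h => hv ((modulus_le_iff hK v).mpr h)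
    rw [psiFour_apply]
    refine mul_ne_zero (psi_ne_zero hK e hv') (chiFour_ne_zero_of_odd ?_)
    rw [norm_emod_two]; exact re_gen_odd hK hv'
  · rw [idealPow_psiFour_span hK e hb, idealPow_psiFour_span hK e hc, prod_embedding_zpow_embType, map_div₀]
    set b' := hK.ringEquiv.symm b with hb'
    set c' := hK.ringEquiv.symm c with hc'
    have hbK : (b : K) = ((hK.ringEquiv b' : 𝓞 K) : K) := by rw [hb', RingEquiv.apply_symm_apply]
    have hcK : (c : K) = ((hK.ringEquiv c' : 𝓞 K) : K) := by rw [hc', RingEquiv.apply_symm_apply]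
    have hdvd : (4 * Zsqrtd.sqrtd : ℤ√(-2)) ∣ b' - c' := by
      have h1 : b - c ∈ hK.modulus := hbc
      rw [FieldData.modulus, Ideal.mem_span_singleton] at h1
      have h2 := (map_dvd_iff hK.ringEquiv.symm).mpr h1
      rwa [RingEquiv.symm_apply_apply, map_sub] at h2
    have hdvd4 : ((4 : ℕ) : ℤ√(-2)) ∣ b' - c' := (Dvd.intro _ rfl : (4 : ℤ√(-2)) ∣ 4 * Zsqrtd.sqrtd).trans hdvd
    have hχN : ((χ₄ ((b'.norm : ℤ) : ZMod 4) : ℤ) : ℂ) = ((χ₄ ((c'.norm : ℤ) : ZMod 4) : ℤ) : ℂ) := by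
      obtain ⟨k, hk⟩ := natCast_dvd_norm_sub_norm hdvd4
      push_cast at hk
      rw [show b'.norm = c'.norm + 4 * k by linarith, Int.cast_add, Int.cast_mul, show ((4 : ℤ) : ZMod 4) = 0 from rfl, zero_mul, add_zero]
    have hc0 : e (c : K) ≠ 0 := by rw [map_ne_zero]; exact_mod_cast hc
    rw [mul_div_assoc', eq_div_iff hc0, hbK, hcK, ← FieldData.toComplex_apply, ← FieldData.toComplex_apply, hχN]
    have key : hK.toComplex e (primary b') * hK.toComplex e c' = hK.toComplex e (primary c') * hK.toComplex e b' := by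
      rw [← map_mul, ← map_mul, primary_mul_eq_primary_mul_of_dvd_sub hdvd]
    linear_combination ((χ₄ ((c'.norm : ℤ) : ZMod 4) : ℤ) : ℂ) * key

omit hK in
/-- For `e` the embedding of an infinite place, the twisted character has the literal type `(fun _ ↦ 1, fun _ ↦ 0)`. [cite: SilvermanATAEC1994, II Thm. 9.2 (a)] -/
private theorem embType_eq_one_zero' (hK : FieldData θ) (w₀ : InfinitePlace K) :
    embType w₀.embedding = (fun _ : InfinitePlace K => (1 : ℤ)) ∧ embTypeConj w₀.embedding = (fun _ : InfinitePlace K => (0 : ℤ)) := by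
  constructor
  · funext w; rw [hK.infinitePlace_eq w w₀, embType, if_pos rfl]
  · funext w; rw [hK.infinitePlace_eq w w₀, embTypeConj, if_pos rfl]

/-- ★★ **The literal type-`(1, 0)` form** of the twisted datum. [cite: SilvermanATAEC1994, II Thm. 9.2 (a)] [cite: NeukirchANT1999, Ch. VII §6 Cor. (6.14)] -/
theorem isGrossencharakter_psiFour_one_zero (w₀ : InfinitePlace K) :
    IsGrossencharakter hK.modulus (fun _ => 1) (fun _ => 0) (psiFour hK w₀.embedding) := by
  obtain ⟨h1, h2⟩ := embType_eq_one_zero' hK w₀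
  rw [← h1, ← h2]
  exact isGrossencharakter_psiFour hK w₀.embedding

/-! ### §4 Frobenius matching: `(−1/p) S(p)`, `p`, `−p` -/

/-- ★★ **Frobenius matching for `ψ₄` against `a_p = χ₄(p) S(p)`** (`= (−1/p)(π + π̄) = a_p(B₁)`) at a prime `p ≠ 2`, `v ∣ p`: split
`ψ₄(v) + ψ₄(c • v) = a_p`, `ψ₄(v) ψ₄(c • v) = p`; inert `a_p = 0`, `ψ₄(v) = −p`. [cite: Rajwade1968, Thm. 1] [cite: SilvermanATAEC1994, II Ex. 2.30 (b), (c)] -/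
theorem frobenius_psiFour_of_eq (e : K →+* ℂ) {c : K ≃ₐ[ℚ] K} (hc : c ≠ 1) {p : ℕ} (hp : p.Prime) (hp2 : p ≠ 2)
    {t : ℤ} (ht : ((t : ℤ) : ℤ√(-2)) = (χ₄ (p : ZMod 4) : ℤ√(-2)) * primarySum p)
    {v : HeightOneSpectrum (𝓞 K)} (hv : (p : 𝓞 K) ∈ v.asIdeal) :
    (c • v ≠ v → psiFour hK e v + psiFour hK e (c • v) = (t : ℂ) ∧ psiFour hK e v * psiFour hK e (c • v) = p) ∧
    (c • v = v → t = 0 ∧ psiFour hK e v = -(p : ℂ)) := by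
  have hNc : (gen hK (c • v)).norm = (gen hK v).norm := by
    rw [norm_eq_of_associated (associated_gen_smul hK hc v), Zsqrtd.norm_conj]
  have hpodd : (p : ℤ) % 2 = 1 := by exact_mod_cast Nat.odd_iff.mp (hp.odd_of_ne_two hp2)
  have hχp : ((χ₄ (p : ZMod 4) : ℤ) : ℂ) ^ 2 = 1 := by
    have := chiFour_sq_eq_one_of_odd hpodd; rwa [Int.cast_natCast] at this
  refine ⟨fun hne => ?_, fun heq => ?_⟩
  · have hN : (gen hK v).norm = p := by
      rcases norm_gen_eq_or hK hp hv with h | h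
      · exact h
      · exact absurd (inert_of_norm_gen_eq_sq hK e hc hp hp2 hv h).2.1 hne
    obtain ⟨-, hsum, hprod⟩ := split_of_norm_gen_eq hK e hc hp hp2 hN
    rw [psiFour_apply, psiFour_apply, hNc, hN, Int.cast_natCast]
    refine ⟨?_, ?_⟩
    · rw [← add_mul, hsum]
      have ht' : (t : ℂ) = ((χ₄ (p : ZMod 4) : ℤ) : ℂ) * hK.toComplex e (primarySum p) := by
        have := congrArg (hK.toComplex e) ht
        rwa [map_intCast, map_mul, map_intCast] at this
      rw [ht', mul_comm]
    · rw [mul_mul_mul_comm, hprod, ← sq, hχp, mul_one]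
  · have hN : (gen hK v).norm = (p : ℤ) ^ 2 := by
      rcases norm_gen_eq_or hK hp hv with h | h
      · exact absurd heq (split_of_norm_gen_eq hK e hc hp hp2 h).1
      · exact h
    obtain ⟨-, -, hS, hψ⟩ := inert_of_norm_gen_eq_sq hK e hc hp hp2 hv hN
    refine ⟨?_, ?_⟩
    · rw [hS, mul_zero] at ht
      exact_mod_cast (Int.cast_injective (α := ℤ√(-2))) (by rw [ht, Int.cast_zero])
    · rw [psiFour_apply, hψ, hN, Int.cast_pow, Int.cast_natCast, map_pow, Int.cast_pow, hχp, mul_one]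

omit hK in
/-- `p ∈ 𝔭_{c • v} ↔ p ∈ 𝔭_v`. [cite: SilvermanATAEC1994, II Ex. 2.30] -/
private theorem natCast_mem_smul_asIdeal_iff' (c : K ≃ₐ[ℚ] K) (v : HeightOneSpectrum (𝓞 K)) (p : ℕ) :
    (p : 𝓞 K) ∈ (c • v).asIdeal ↔ (p : 𝓞 K) ∈ v.asIdeal := by
  have h : c • (p : 𝓞 K) = p := by
    apply RingOfIntegers.ext
    rw [Literature.NumberTheory.Automorphic.RingOfIntegers.coe_algEquiv_smul]
    push_cast
    exact map_natCast c p
  conv_lhs => rw [← h]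
  exact Literature.NumberTheory.Automorphic.HeightOneSpectrum.smul_mem_smul_asIdeal_iff c v (p : 𝓞 K)

/-- ★★ **The `χ₄`-twisted datum packaged in the shape of Deuring's theorem** (`𝔣 = (4√−2)`, `𝔣 ∣ 𝔭_v ↔ 2 ∈ 𝔭_v`, `ψ₀ = ψ₄` of type `(1,0)`,
conj-equivariant, `ψ̃₀((n)) = −n` for `n ≡ 5, 7 (mod 8)`, and Deuring's values against `f p` with `f p = χ₄(p) S(p)` at the odd primes).
[cite: SilvermanATAEC1994, II Thm. 9.2 and Ex. 2.30 (b), (c)] [cite: Rajwade1968, Thm. 1] -/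
theorem exists_isGrossencharakter_datum_chiFour {c : K ≃ₐ[ℚ] K} (hc : c ≠ 1) (w₀ : InfinitePlace K) (f : ℕ → ℤ)
    (hf : ∀ p : ℕ, p.Prime → p ≠ 2 → ((f p : ℤ) : ℤ√(-2)) = (χ₄ (p : ZMod 4) : ℤ√(-2)) * primarySum p) :
    ∃ (𝔣 : Ideal (𝓞 K)) (ψ₀ : HeightOneSpectrum (𝓞 K) → ℂ), 𝔣 ≠ ⊥ ∧
      (∀ v : HeightOneSpectrum (𝓞 K), 𝔣 ≤ v.asIdeal ↔ (2 : 𝓞 K) ∈ v.asIdeal) ∧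
      IsGrossencharakter 𝔣 (fun _ => 1) (fun _ => 0) ψ₀ ∧
      (∀ v : HeightOneSpectrum (𝓞 K), ψ₀ (c • v) = conj (ψ₀ v)) ∧
      (∀ n : ℕ, (n % 8 = 5 ∨ n % 8 = 7) → idealPow K ψ₀ (Ideal.span {(n : 𝓞 K)}) = -(n : ℂ)) ∧
      ∀ (p : ℕ), p.Prime → p ≠ 2 → ∀ v : HeightOneSpectrum (𝓞 K), (p : 𝓞 K) ∈ v.asIdeal →
        ¬ 𝔣 ≤ v.asIdeal ∧
        (c • v ≠ v → ψ₀ v + ψ₀ (c • v) = (f p : ℂ) ∧ ψ₀ v * ψ₀ (c • v) = p) ∧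
        (c • v = v → f p = 0 ∧ ψ₀ v = -(p : ℂ)) :=
  ⟨hK.modulus, psiFour hK w₀.embedding, hK.modulus_ne_bot, modulus_le_iff_two_mem hK, isGrossencharakter_psiFour_one_zero hK w₀,
    psiFour_smul_eq_conj hK w₀.embedding hc, fun _ hn8 => idealPow_psiFour_span_natCast_of_mod_eight hK w₀.embedding hn8,
    fun _ hp hp2 _ hv => ⟨not_modulus_le_of_natCast_mem hK hp hp2 hv, frobenius_psiFour_of_eq hK w₀.embedding hc hp hp2 (hf _ hp hp2) hv⟩⟩

/-- ★★ **The algebraic Hecke character with Frobenius values `a_p = χ₄(p) S(p)`** (the character of `B₁`; clauses (i), (iv) of Deuring's theorem,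
via `heckeOfGross`, Neukirch VII (6.14)). [cite: SilvermanATAEC1994, II Thm. 9.2 (a), Thm. 10.5 (b), Ex. 2.30 (b), (c)] [cite: NeukirchANT1999, Ch. VII §6 Cor. (6.14)] -/
theorem exists_heckeCharacter_of_eq_chiFour_mul_primarySum {c : K ≃ₐ[ℚ] K} (hc : c ≠ 1) (w₀ : InfinitePlace K) (f : ℕ → ℤ)
    (hf : ∀ p : ℕ, p.Prime → p ≠ 2 → ((f p : ℤ) : ℤ√(-2)) = (χ₄ (p : ZMod 4) : ℤ√(-2)) * primarySum p) :
    ∃ ψ : HeckeCharacter K, ψ.HasInfinityType (fun _ => 1) (fun _ => 0) ∧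
      ∀ (p : ℕ), p.Prime → p ≠ 2 → ∀ v : HeightOneSpectrum (𝓞 K), (p : 𝓞 K) ∈ v.asIdeal →
        ψ.IsUnramifiedAt v ∧ ψ.valueAtUniformizer (c • v) = conj (ψ.valueAtUniformizer v) ∧
        (c • v ≠ v → ψ.valueAtUniformizer v + ψ.valueAtUniformizer (c • v) = (f p : ℂ) ∧
          ψ.valueAtUniformizer v * ψ.valueAtUniformizer (c • v) = p) ∧
        (c • v = v → f p = 0 ∧ ψ.valueAtUniformizer v = -(p : ℂ)) := by
  have h𝔣 := hK.modulus_ne_bot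
  have hψ := isGrossencharakter_psiFour_one_zero hK w₀
  refine ⟨heckeOfGross h𝔣 hψ, heckeOfGross_hasInfinityType h𝔣 hψ, fun p hp hp2 v hv => ?_⟩
  have hv' : ¬ hK.modulus ≤ v.asIdeal := not_modulus_le_of_natCast_mem hK hp hp2 hv
  have hcv : (p : 𝓞 K) ∈ (c • v).asIdeal := (natCast_mem_smul_asIdeal_iff' c v p).mpr hv
  have hcv' : ¬ hK.modulus ≤ (c • v).asIdeal := not_modulus_le_of_natCast_mem hK hp hp2 hcv
  rw [heckeOfGross_valueAtUniformizer h𝔣 hψ hv', heckeOfGross_valueAtUniformizer h𝔣 hψ hcv']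
  exact ⟨heckeOfGross_isUnramifiedAt h𝔣 hψ hv', psiFour_smul_eq_conj hK w₀.embedding hc v,
    frobenius_psiFour_of_eq hK w₀.embedding hc hp hp2 (hf p hp hp2) hv⟩

end Twist

/-! ### §5 (appended) The same datum with `(−1/p)` spelled as Mathlib's Jacobi symbol -/

section NegOne

variable (hK : FieldData θ)
include hK

/-- ★★ **The `χ₄`-twisted datum under the hypothesis `f p = (−1/p) · S(p)`** (`jacobiSym (-1) p`, the spelling of the tree's
`SqrtTwoTwist.lFunction_eq_jacobiSym_mul_primarySum` at `n = 1`): the same six-conjunct conclusion as `exists_isGrossencharakter_datum`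
(`(−1/p) = χ₄(p)` for odd `p`, Mathlib `jacobiSym.at_neg_one`). [cite: Rajwade1968, Thm. 1] [cite: SilvermanATAEC1994, II Thm. 9.2 and Ex. 2.30 (b), (c)] -/
theorem exists_isGrossencharakter_datum_negOne {c : K ≃ₐ[ℚ] K} (hc : c ≠ 1) (w₀ : InfinitePlace K) (f : ℕ → ℤ)
    (hf : ∀ p : ℕ, p.Prime → p ≠ 2 → ((f p : ℤ) : ℤ√(-2)) = (jacobiSym (-1) p : ℤ√(-2)) * primarySum p) :
    ∃ (𝔣 : Ideal (𝓞 K)) (ψ₀ : HeightOneSpectrum (𝓞 K) → ℂ), 𝔣 ≠ ⊥ ∧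
      (∀ v : HeightOneSpectrum (𝓞 K), 𝔣 ≤ v.asIdeal ↔ (2 : 𝓞 K) ∈ v.asIdeal) ∧
      IsGrossencharakter 𝔣 (fun _ => 1) (fun _ => 0) ψ₀ ∧
      (∀ v : HeightOneSpectrum (𝓞 K), ψ₀ (c • v) = conj (ψ₀ v)) ∧
      (∀ n : ℕ, (n % 8 = 5 ∨ n % 8 = 7) → idealPow K ψ₀ (Ideal.span {(n : 𝓞 K)}) = -(n : ℂ)) ∧
      ∀ (p : ℕ), p.Prime → p ≠ 2 → ∀ v : HeightOneSpectrum (𝓞 K), (p : 𝓞 K) ∈ v.asIdeal →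
        ¬ 𝔣 ≤ v.asIdeal ∧
        (c • v ≠ v → ψ₀ v + ψ₀ (c • v) = (f p : ℂ) ∧ ψ₀ v * ψ₀ (c • v) = p) ∧
        (c • v = v → f p = 0 ∧ ψ₀ v = -(p : ℂ)) :=
  exists_isGrossencharakter_datum_chiFour hK hc w₀ f fun p hp hp2 => by
    rw [hf p hp hp2, jacobiSym.at_neg_one (hp.odd_of_ne_two hp2)]

/-- ★★ The algebraic Hecke character with Frobenius values `a_p = (−1/p) S(p)` (Jacobi-symbol spelling). [cite: SilvermanATAEC1994, II Thm. 9.2 (a), Thm. 10.5 (b), Ex. 2.30 (b), (c)] [cite: Rajwade1968, Thm. 1] -/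
theorem exists_heckeCharacter_of_eq_jacobiSym_negOne_mul_primarySum {c : K ≃ₐ[ℚ] K} (hc : c ≠ 1) (w₀ : InfinitePlace K) (f : ℕ → ℤ)
    (hf : ∀ p : ℕ, p.Prime → p ≠ 2 → ((f p : ℤ) : ℤ√(-2)) = (jacobiSym (-1) p : ℤ√(-2)) * primarySum p) :
    ∃ ψ : HeckeCharacter K, ψ.HasInfinityType (fun _ => 1) (fun _ => 0) ∧
      ∀ (p : ℕ), p.Prime → p ≠ 2 → ∀ v : HeightOneSpectrum (𝓞 K), (p : 𝓞 K) ∈ v.asIdeal →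
        ψ.IsUnramifiedAt v ∧ ψ.valueAtUniformizer (c • v) = conj (ψ.valueAtUniformizer v) ∧
        (c • v ≠ v → ψ.valueAtUniformizer v + ψ.valueAtUniformizer (c • v) = (f p : ℂ) ∧
          ψ.valueAtUniformizer v * ψ.valueAtUniformizer (c • v) = p) ∧
        (c • v = v → f p = 0 ∧ ψ.valueAtUniformizer v = -(p : ℂ)) :=
  exists_heckeCharacter_of_eq_chiFour_mul_primarySum hK hc w₀ f fun p hp hp2 => by
    rw [hf p hp hp2, jacobiSym.at_neg_one (hp.odd_of_ne_two hp2)]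

end NegOne

end Literature.NumberTheory.QuadraticFields.SqrtNegTwo

end
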